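import Mathlib
import Summits.Ventures.Crystal3D.Theorems.StickyWulffConstantTextureLiminfTentCurrency
import Summits.Ventures.Crystal3D.Theorems.StickyWulffConstantTextureLiminfTentMass
import Summits.Ventures.Crystal3D.Theorems.StickyWulffConstantTextureLiminfTentPieces
import Literature.Analysis.Convexity.AnisotropicPerimeterPLCoarea
import Literature.Analysis.Convexity.AnisotropicPerimeterLevelSetsLocal
import Literature.Analysis.Convexity.AnisotropicPerimeterLevelSets
import Literature.Analysis.Convexity.AnisotropicPerimeterComplement
import Literature.MathematicalPhysics.StatisticalMechanics.FccWulffBodyHull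
import HarnessLib

/-!
# The tent certificate for fcc grains — the FREE certificate in local currency (eng g8)

Route `StickyWulffConstant` (`Summits/Ventures/Crystal3D`, cell `crystal3d-full`), support toward the crux
`TextureLiminf` (stmt-Ventures-19483), FREE half: the planner's `BarlowFreeCertificate` (TexShadow v6.1,
form (a), ∃-level per open set) in the cubic coefficient frame of the fcc lattice
(`site n = (√2)⁻¹ • (n₀+n₁, n₀+n₂, n₁+n₂)`, Wulff body `fccWulffBody`, `h_W = phiFcc`).

`tent_free_certificate`: for every finite `X` and every set `U` there is a level `t ∈ (0,1)` such that the
super-level set `G = {f_X > t}` of the tent of `X` lies in the closed cells of the complex of `X` and, for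
every `C¹` compactly supported `fccWulffBody`-valued field `ξ` with `tsupport ξ ⊆ U`,
`2 · ∫_G div ξ ≤ brokenNear X U` = the number of ordered broken bonds of `X` whose occupied end is within
`√2` of `U`.  Assembly of: the level-set toolkit (`Literature/Analysis/Convexity/AnisotropicPerimeter*`,
parts III–V: divergence pairing on generic super-level sets of a piecewise-affine function, PL coarea),
the combinatorial tent tables of lit g9 (`…TentTables*.lean`: `tentCostOn24_le`), and the geometric
files `…TentHat* / TentCell* / TentClassify / TentComplex / TentCost / TentCurrency / TentMass / TentPlanes / TentPieces`.
WHAT THIS IS NOT: the Barlow-frame transport (`A i '' fccRef + u`, slabs) of the registered stub — that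
is the next step; F-C1 not moved.
-/

noncomputable section

namespace Summit.Ventures.Crystal3D.TentCertificate

open Finset Summit.Ventures.Crystal3D MeasureTheory Literature.Analysis.Convexity
open Literature.Geometry.DiscreteGeometry (intVec intVec_apply)
open Literature.MathematicalPhysics.StatisticalMechanics (phiFcc phiFcc_nonneg phiFcc_neg fccWulffBody
  truncOctVertexInt isGreatest_inner_fccWulffBody fieldDivergence HasFinitePerimeter zero_mem_fccWulffBody
  isCompact_fccWulffBody)
open Summit.Ventures.Crystal3D.Cruxes.TextureLiminf.TexShadow (polytope)
open scoped RealInnerProductSpace ENNReal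

/-- The support value of the Wulff body in direction `−g` is `phiFcc g`. -/
theorem sSup_inner_fccWulffBody_neg (g : EuclideanSpace ℝ (Fin 3)) :
    sSup ((fun y : EuclideanSpace ℝ (Fin 3) => ⟪y, -g⟫) '' fccWulffBody) = phiFcc g := by
  rw [(isGreatest_inner_fccWulffBody (-g)).csSup_eq, phiFcc_neg]

/-- **The tent certificate (cubic frame).**  For every finite site set `X` and every `U` there is a level
`t ∈ (0,1)` whose super-level set `{f_X > t}` lies in the closed cells of the complex of `X`, within `√2`
of the occupied sites, contains every point all of whose sites within `√2` are occupied, is up to a null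
set a finite disjoint union of bounded open polytopes with unit normals and distinct facet planes (each in
one cell, hence one bilayer slab), and satisfies, for every admissible field supported in `U`,
`2 ∫_{f_X > t} div ξ ≤ brokenNear X U`; moreover the SAME level admits slab-wise bounds `C i` ((111) bilayer
slabs `2i < ⟪(1,1,1), √2 x⟫ < 2i+2`, which own the cells) with `2 Σ_i C i ≤ brokenNear X U`. -/
theorem tent_free_certificate (X : Finset Site) (U : Set (EuclideanSpace ℝ (Fin 3))) :
    ∃ t ∈ Set.Ioo (0 : ℝ) 1,
      {x | t < tent X x} ⊆ (⋃ ℓ ∈ labelsOf X, closure (cellOf ℓ.1 ℓ.2)) ∧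
      {x | t < tent X x} ⊆ (⋃ a ∈ X, Metric.closedBall (site a) (Real.sqrt 2)) ∧
      {y | ∀ a : Site, dist y (site a) ≤ Real.sqrt 2 → a ∈ X} ⊆ {x | t < tent X x} ∧
      (∃ (J : ℕ) (Hd : Fin J → Finset (EuclideanSpace ℝ (Fin 3) × ℝ)),
        (∀ j, Bornology.IsBounded (polytope (Hd j))) ∧ (∀ j, ∀ p ∈ Hd j, ‖p.1‖ = 1) ∧
        (∀ j, ∀ p ∈ Hd j, ∀ p' ∈ Hd j, p ≠ p' →
          {x : EuclideanSpace ℝ (Fin 3) | ⟪p.1, x⟫ = p.2} ≠ {x | ⟪p'.1, x⟫ = p'.2}) ∧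
        (∀ j j', j ≠ j' → Disjoint (polytope (Hd j)) (polytope (Hd j'))) ∧
        (∀ j, ∃ ℓ ∈ labelsOf X, polytope (Hd j) ⊆ cellOf ℓ.1 ℓ.2) ∧
        (∀ j, ∃ i : ℤ, polytope (Hd j) ⊆ {x | (2 * i : ℝ) < ⟪intVec (normal4 0), Real.sqrt 2 • x⟫ ∧
          ⟪intVec (normal4 0), Real.sqrt 2 • x⟫ < 2 * i + 2}) ∧
        (⋃ j, polytope (Hd j)) ⊆ {x | t < tent X x} ∧
        volume ({x | t < tent X x} \ ⋃ j, polytope (Hd j)) = 0 ∧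
        HasFinitePerimeter (⋃ j, polytope (Hd j)) ∧ volume (⋃ j, polytope (Hd j)) < ⊤) ∧
      (∀ ξ : EuclideanSpace ℝ (Fin 3) → EuclideanSpace ℝ (Fin 3), ContDiff ℝ 1 ξ → HasCompactSupport ξ →
        (∀ z, ξ z ∈ fccWulffBody) → tsupport ξ ⊆ U →
        2 * ∫ z in {x | t < tent X x}, fieldDivergence ξ z ≤ (brokenNear X U : ℝ)) ∧
      ∃ C : ℤ → ℝ, (∀ i, 0 ≤ C i) ∧ (∀ s : Finset ℤ, 2 * ∑ i ∈ s, C i ≤ (brokenNear X U : ℝ)) ∧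
        ∀ (i : ℤ) (ξ : EuclideanSpace ℝ (Fin 3) → EuclideanSpace ℝ (Fin 3)), ContDiff ℝ 1 ξ →
          HasCompactSupport ξ → (∀ z, ξ z ∈ fccWulffBody) →
          tsupport ξ ⊆ U ∩ {x | (2 * i : ℝ) < ⟪intVec (normal4 0), Real.sqrt 2 • x⟫ ∧
            ⟪intVec (normal4 0), Real.sqrt 2 • x⟫ < 2 * i + 2} →
          ∫ z in {x | t < tent X x}, fieldDivergence ξ z ≤ C i := by
  classical
  -- enumerate the complex
  set L := labelsOf X with hL
  set N := L.card with hN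
  let e : {ℓ // ℓ ∈ L} ≃ Fin N := L.equivFin
  let lab : Fin N → (Fin 3 → ℤ) × (Fin 4 → ℤ) := fun i => (e.symm i).1
  have hlab : ∀ i, lab i ∈ L := fun i => (e.symm i).2
  have hlab_inj : Function.Injective lab := fun i j h => e.symm.injective (Subtype.ext h)
  let H : Fin N → Finset (EuclideanSpace ℝ (Fin 3) × ℝ) := fun i => chamberH (lab i).1 (lab i).2
  let Q : Fin N → Set (EuclideanSpace ℝ (Fin 3)) := fun i => cellOf (lab i).1 (lab i).2
  have hQ : ∀ i, Q i = ⋂ p ∈ H i, {x : EuclideanSpace ℝ (Fin 3) | ⟪p.1, x⟫ < p.2} := fun i => rfl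
  have hbd : ∀ i, Bornology.IsBounded (Q i) := fun i => isBounded_cellOf _ _
  have hdisj : ∀ i j, i ≠ j → Disjoint (Q i) (Q j) := by
    intro i j hij
    refine disjoint_cellOf fun h => hij (hlab_inj ?_)
    exact Prod.ext (congrArg Prod.fst h) (congrArg Prod.snd h)
  -- affine data
  choose g b hgb using fun i => exists_affine_tent X (lab i).1 (lab i).2
  have hf : ∀ i, ∀ x ∈ closure (Q i), tent X x = ⟪g i, x⟫ + b i :=
    fun i x hx => hgb i x (closure_cellOf_subset_closedChamber _ _ hx)
  -- the complex carries the tent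
  have hcovL : ∀ t : ℝ, 0 ≤ t → {x | t < tent X x} ⊆ ⋃ ℓ ∈ labelsOf X, closure (cellOf ℓ.1 ℓ.2) :=
    fun t ht => superlevel_subset_closure_cells X ht
  have hcov : ∀ t : ℝ, 0 ≤ t → {x | t < tent X x} ⊆ ⋃ i, closure (Q i) := by
    intro t ht x hx
    obtain ⟨ℓ, hℓ, hxℓ⟩ := Set.mem_iUnion₂.1 (hcovL t ht hx)
    refine Set.mem_iUnion.2 ⟨e ⟨ℓ, hℓ⟩, ?_⟩
    have : lab (e ⟨ℓ, hℓ⟩) = ℓ := by simp [lab]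
    show x ∈ closure (cellOf (lab (e ⟨ℓ, hℓ⟩)).1 (lab (e ⟨ℓ, hℓ⟩)).2)
    rw [this]; exact hxℓ
  -- the cells meeting `U` with nonzero gradient, the majorant and its integral
  set S : Finset (Fin N) := Finset.univ.filter fun i => g i ≠ 0 ∧ (closure (Q i) ∩ U).Nonempty with hS
  have hSmem : ∀ i, g i ≠ 0 → (closure (Q i) ∩ U).Nonempty → i ∈ S :=
    fun i h1 h2 => Finset.mem_filter.2 ⟨Finset.mem_univ _, h1, h2⟩
  let A : Fin N → ℝ → ℝ≥0∞ := fun i t => volume {x : EuclideanSpace ℝ (Fin 3) |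
    ∃ y ∈ closure (Q i) ∩ {x | tent X x = t}, ∃ τ ∈ Set.Icc (0 : ℝ) 1, x = y + τ • (-(‖g i‖⁻¹ • g i))}
  let c : Fin N → ℝ := fun i =>
    sSup ((fun y : EuclideanSpace ℝ (Fin 3) => ⟪y, -(‖g i‖⁻¹ • g i)⟫) '' fccWulffBody)
  have hc0 : ∀ i, 0 ≤ c i := fun i => sSup_inner_nonneg isCompact_fccWulffBody zero_mem_fccWulffBody _
  let F : ℝ → ℝ≥0∞ := fun t => ∑ i ∈ S, ENNReal.ofReal (c i) * A i t
  have hFm : Measurable F := by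
    refine Finset.measurable_sum _ fun i hi => ?_
    exact (measurable_volume_prism_levelFacet isClosed_closure.measurableSet (g i)
      (Finset.mem_filter.1 hi).2.1 (b i) (hf i)).const_mul _
  -- the total: `∫⁻_{t>0} F ≤ Σ_{i∈S} phiFcc(g i) |Q i| =: Ctot`
  set Ctot : ℝ := ∑ i ∈ S, phiFcc (g i) * (volume (Q i)).toReal with hCtot
  have hCtot0 : 0 ≤ Ctot := Finset.sum_nonneg fun i _ => mul_nonneg (phiFcc_nonneg _) ENNReal.toReal_nonneg
  have hvolQ : ∀ i, volume (Q i) ≠ ⊤ := fun i => (hbd i).measure_lt_top.ne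
  have hint : ∫⁻ t in Set.Ioi (0 : ℝ), F t ≤ ENNReal.ofReal Ctot := by
    have h1 : ∫⁻ t in Set.Ioi (0 : ℝ), F t = ∑ i ∈ S, ENNReal.ofReal (c i) *
        (ENNReal.ofReal ‖g i‖ * volume (Q i ∩ {x | 0 < tent X x})) := by
      rw [lintegral_finsetSum _ fun i hi => ((measurable_volume_prism_levelFacet
        isClosed_closure.measurableSet (g i) (Finset.mem_filter.1 hi).2.1 (b i) (hf i)).const_mul _)]
      refine Finset.sum_congr rfl fun i hi => ?_
      rw [lintegral_const_mul _ (measurable_volume_prism_levelFacet isClosed_closure.measurableSet (g i)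
        (Finset.mem_filter.1 hi).2.1 (b i) (hf i)),
        lintegral_Ioi_volume_prism_levelFacet (convex_cellOf' _ _) (g i) (Finset.mem_filter.1 hi).2.1 (b i)
          (hf i) 0]
    rw [h1, hCtot, ENNReal.ofReal_sum_of_nonneg fun i _ =>
      mul_nonneg (phiFcc_nonneg _) ENNReal.toReal_nonneg]
    refine Finset.sum_le_sum fun i hi => ?_
    have hgi : g i ≠ 0 := (Finset.mem_filter.1 hi).2.1
    rw [← mul_assoc, ← ENNReal.ofReal_mul (hc0 i), sSup_inner_image_neg_unit_mul_norm _ _ hgi,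
      sSup_inner_fccWulffBody_neg, ENNReal.ofReal_mul (phiFcc_nonneg _),
      ENNReal.ofReal_toReal (hvolQ i)]
    gcongr
    exact Set.inter_subset_left
  -- bad levels (level plane = a facet plane) are finitely many: force them to `⊤`
  set Bad : Set ℝ := {t : ℝ | ∃ i, g i ≠ 0 ∧ ∃ p ∈ H i,
    {x : EuclideanSpace ℝ (Fin 3) | ⟪g i, x⟫ + b i = t} = {x | ⟪p.1, x⟫ = p.2}} with hBad
  have hBadf : Bad.Finite := finite_setOf_levelPlane_eq_facetPlane H g b
  let F' : ℝ → ℝ≥0∞ := fun t => if t ∈ Bad then ⊤ else F t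
  have hF'm : Measurable F' := Measurable.ite hBadf.measurableSet measurable_const hFm
  have hF'F : F' =ᵐ[volume.restrict (Set.Ioo (0:ℝ) 1)] F := by
    have hnull : ∀ᵐ t ∂(volume.restrict (Set.Ioo (0:ℝ) 1)), t ∉ Bad :=
      ae_restrict_of_ae (hBadf.countable.ae_notMem _)
    filter_upwards [hnull] with t ht
    simp [F', ht]
  have hint' : ∫⁻ t in Set.Ioo (0 : ℝ) 1, F' t ≤ ENNReal.ofReal Ctot * ENNReal.ofReal (1 - 0) := by
    rw [lintegral_congr_ae hF'F, sub_zero, ENNReal.ofReal_one, mul_one]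
    exact le_trans (lintegral_mono_set Set.Ioo_subset_Ioi_self) hint
  obtain ⟨t, ht, hFt⟩ := exists_mem_Ioo_le_of_lintegral_le (P := F') zero_lt_one ENNReal.ofReal_ne_top
    hF'm.aemeasurable hint'
  -- the good level
  have htBad : t ∉ Bad := by
    intro hmem
    have : F' t = ⊤ := by simp [F', hmem]
    rw [this, top_le_iff] at hFt
    exact ENNReal.ofReal_ne_top hFt
  have hFt' : F t ≤ ENNReal.ofReal Ctot := by simpa [F', htBad] using hFt
  have hgen : ∀ i, g i ≠ 0 → ∀ p ∈ H i,
      {x : EuclideanSpace ℝ (Fin 3) | ⟪g i, x⟫ + b i = t} ≠ {x | ⟪p.1, x⟫ = p.2} :=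
    fun i hi p hp heq => htBad ⟨i, hi, p, hp, heq⟩
  -- the cost side: `Ctot ≤ ½ brokenNear X U`
  -- representatives `(p, κ)` of the labels
  have hrep : ∀ i, ∃ r : Site × (Bool ⊕ (Fin 3 → Bool)), r.1 ∈ idx X ∧ labelOf r.1 r.2 = lab i := by
    intro i
    have := hlab i
    rw [hL, labelsOf, Finset.mem_image] at this
    obtain ⟨r, hr, hrl⟩ := this
    exact ⟨r, (Finset.mem_product.1 hr).1, hrl⟩
  choose rep hrep1 hrep2 using hrep
  have hrep_inj : Set.InjOn rep ↑S := by
    intro i _ j _ h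
    apply hlab_inj
    rw [← hrep2 i, ← hrep2 j, h]
  let meets : Site → (Bool ⊕ (Fin 3 → Bool)) → Prop := fun p κ =>
    (closedChamber (labelOf p κ).1 (labelOf p κ).2 ∩ U).Nonempty
  let costR : Site × (Bool ⊕ (Fin 3 → Bool)) → ℝ := fun r =>
    Sum.elim (fun bb => if bb then (2 * eTetUp X r.1 : ℝ) else (2 * eTetDn X r.1 : ℝ))
      (fun s => (corner (patO X r.1) (octIdx 0 (s 0)) (octIdx 1 (s 1)) (octIdx 2 (s 2)) : ℝ)) r.2
  have hcostR0 : ∀ r, 0 ≤ costR r := by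
    rintro ⟨p, κ⟩
    rcases κ with bb | s
    · have hu : (0 : ℤ) ≤ eTetUp X p := Finset.sum_nonneg fun i _ => Finset.sum_nonneg fun j _ => by
        split_ifs <;> norm_num
      have hd : (0 : ℤ) ≤ eTetDn X p := Finset.sum_nonneg fun i _ => Finset.sum_nonneg fun j _ => by
        split_ifs <;> norm_num
      cases bb <;> simp [costR] <;> exact_mod_cast (by omega)
    · simp only [costR, Sum.elim_inr]; exact_mod_cast phiZ_nonneg _ _ _
  -- per-cell cost
  have hcell : ∀ i ∈ S, phiFcc (g i) * (volume (Q i)).toReal ≤ costR (rep i) / 24 := by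
    intro i _
    have hQi : Q i = cellOf (labelOf (rep i).1 (rep i).2).1 (labelOf (rep i).1 (rep i).2).2 := by
      show cellOf (lab i).1 (lab i).2 = _; rw [hrep2 i]
    have hgbi : ∀ x ∈ closedChamber (labelOf (rep i).1 (rep i).2).1 (labelOf (rep i).1 (rep i).2).2,
        tent X x = ⟪g i, x⟫ + b i := by rw [hrep2 i]; exact hgb i
    rw [hQi]
    generalize rep i = r at hgbi ⊢
    obtain ⟨p, κ⟩ := r
    rcases κ with bb | s
    · rcases Bool.eq_false_or_eq_true bb with hb | hb <;> subst hb
      · simp only [labelOf, Sum.elim_inl, if_true, costR] at hgbi ⊢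
        exact cost_labelUp_le X p hgbi
      · simp only [labelOf, Sum.elim_inl, Bool.false_eq_true, if_false, costR] at hgbi ⊢
        exact cost_labelDn_le X p hgbi
    · simp only [labelOf, Sum.elim_inr, costR] at hgbi ⊢
      exact cost_labelCorner_le X p s hgbi
  -- regrouping
  set R : Finset (Site × (Bool ⊕ (Fin 3 → Bool))) :=
    (idx X ×ˢ (Finset.univ : Finset (Bool ⊕ (Fin 3 → Bool)))).filter fun r => meets r.1 r.2 with hR
  have himg : S.image rep ⊆ R := by
    intro r hr
    obtain ⟨i, hi, rfl⟩ := Finset.mem_image.1 hr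
    refine Finset.mem_filter.2 ⟨Finset.mem_product.2 ⟨hrep1 i, Finset.mem_univ _⟩, ?_⟩
    obtain ⟨y, hy, hyU⟩ := (Finset.mem_filter.1 hi).2.2
    refine ⟨y, ?_, hyU⟩
    have := closure_cellOf_subset_closedChamber _ _ hy
    rwa [← hrep2 i] at this
  have hC1 : Ctot ≤ (∑ r ∈ R, costR r) / 24 := by
    calc Ctot ≤ ∑ i ∈ S, costR (rep i) / 24 := Finset.sum_le_sum hcell
      _ = (∑ i ∈ S, costR (rep i)) / 24 := by rw [Finset.sum_div]
      _ = (∑ r ∈ S.image rep, costR r) / 24 := by rw [Finset.sum_image hrep_inj]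
      _ ≤ (∑ r ∈ R, costR r) / 24 := by
        have h := Finset.sum_le_sum_of_subset_of_nonneg himg fun r _ _ => hcostR0 r
        linarith
  set Pup := (idx X).filter fun p => meets p (Sum.inl true) with hPup
  set Pdn := (idx X).filter fun p => meets p (Sum.inl false) with hPdn
  set PO := (idx X).filter fun p => ∃ s, meets p (Sum.inr s) with hPO
  have hC2 : (∑ r ∈ R, costR r) ≤ (tentCostOn24 X Pup Pdn PO : ℝ) :=
    sum_cost_le_tentCostOn24 X (idx X) meets
  have hC3 : (tentCostOn24 X Pup Pdn PO : ℝ) ≤ 12 * ((coveredBonds X Pup Pdn PO).card : ℝ) := by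
    exact_mod_cast tentCostOn24_le X Pup Pdn PO
  have hC4 : ((coveredBonds X Pup Pdn PO).card : ℝ) ≤ (brokenNear X U : ℝ) := by
    have h := card_coveredBonds_le_brokenNear X U Pup Pdn PO
      (fun p hp => by simpa [meets, labelOf] using (Finset.mem_filter.1 hp).2)
      (fun p hp => by simpa [meets, labelOf] using (Finset.mem_filter.1 hp).2)
      (fun p hp => by
        obtain ⟨s, hs⟩ := (Finset.mem_filter.1 hp).2
        exact ⟨s, by simpa [meets, labelOf] using hs⟩)
    exact_mod_cast h
  have hCB : 2 * Ctot ≤ (brokenNear X U : ℝ) := by linarith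
  -- finiteness of the prisms and the real form of `F t`
  have hAfin : ∀ i, A i t ≠ ⊤ := by
    intro i
    refine volume_prism_ne_top_of_isBounded ((hbd i).closure.subset Set.inter_subset_left) _ ?_
    by_cases hgi : g i = 0
    · simp [hgi]
    · rw [norm_neg, norm_smul, norm_inv, norm_norm, inv_mul_cancel₀ (norm_ne_zero_iff.2 hgi)]
  have hterm : ∀ i, c i * (A i t).toReal = (ENNReal.ofReal (c i) * A i t).toReal := by
    intro i; rw [ENNReal.toReal_mul, ENNReal.toReal_ofReal (hc0 i)]
  have hterm0 : ∀ i, 0 ≤ c i * (A i t).toReal := fun i => mul_nonneg (hc0 i) ENNReal.toReal_nonneg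
  have hFreal : ∀ S' : Finset (Fin N), S' ⊆ S → ∑ i ∈ S', c i * (A i t).toReal ≤ Ctot := by
    intro S' hS'
    calc ∑ i ∈ S', c i * (A i t).toReal ≤ ∑ i ∈ S, c i * (A i t).toReal :=
          Finset.sum_le_sum_of_subset_of_nonneg hS' fun i _ _ => hterm0 i
      _ = (F t).toReal := by
          rw [ENNReal.toReal_sum fun i _ => ENNReal.mul_ne_top ENNReal.ofReal_ne_top (hAfin i)]
          exact Finset.sum_congr rfl fun i _ => hterm i
      _ ≤ Ctot := le_trans (ENNReal.toReal_mono ENNReal.ofReal_ne_top hFt')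
          (by rw [ENNReal.toReal_ofReal hCtot0])
  -- slab bookkeeping: a cell whose closure meets the open slab `i` has `m₀ = i`
  have hslab : ∀ j (i : ℤ), (closure (Q j) ∩ {x : EuclideanSpace ℝ (Fin 3) |
      (2 * i : ℝ) < ⟪intVec (normal4 0), Real.sqrt 2 • x⟫ ∧ ⟪intVec (normal4 0), Real.sqrt 2 • x⟫ < 2 * i + 2}).Nonempty →
      (lab j).2 0 = i := by
    rintro j i ⟨y, hy, hy1, hy2⟩
    have hc := (closure_cellOf_subset_closedChamber _ _ hy).2 0
    have h1 : ((lab j).2 0 : ℝ) < i + 1 := by linarith [hc.1]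
    have h2 : (i : ℝ) < (lab j).2 0 + 1 := by linarith [hc.2]
    have h1' : (lab j).2 0 < i + 1 := by exact_mod_cast h1
    have h2' : i < (lab j).2 0 + 1 := by exact_mod_cast h2
    omega
  let C : ℤ → ℝ := fun i => ∑ j ∈ S.filter (fun j => (lab j).2 0 = i), c j * (A j t).toReal
  -- the polytope pieces
  obtain ⟨Hd, hP1, hP2, hP3, hP4, hP5, hP6, hP7⟩ :=
    exists_polytope_pieces X lab hlab_inj g b hgb t hgen (hcov t ht.1.le)
  -- finite perimeter of the union of the pieces: it is a.e. the super-level set, whose perimeter is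
  -- the (finite) facet sum of part III with `K` the unit ball
  have hae : (⋃ j, polytope (Hd j)) =ᵐ[volume] {x | t < tent X x} := by
    refine (ae_eq_set).2 ⟨?_, hP7⟩
    exact measure_mono_null (fun x hx => (hx.2 (hP6 hx.1)).elim) measure_empty
  have hmeasP : ∀ j, MeasurableSet (polytope (Hd j)) := fun j => by
    unfold polytope
    exact (isOpen_biInter_finset fun _ _ =>
      isOpen_lt (continuous_const.inner continuous_id) continuous_const).measurableSet
  have hfin : HasFinitePerimeter (⋃ j, polytope (Hd j)) := by
    refine ⟨MeasurableSet.iUnion hmeasP, ?_⟩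
    rw [perimeter_eq_anisotropicPerimeter_closedBall, anisotropicPerimeter_congr_ae _ hae,
      anisotropicPerimeter_superlevel_eq_levelFacetSum H Q hQ hbd hdisj g b (continuous_tent X) hf
        (isCompact_closedBall 0 1) (convex_closedBall 0 1) (Metric.mem_closedBall_self zero_le_one)
        (hcov t ht.1.le) hgen]
    exact ENNReal.ofReal_lt_top
  have hvolU : volume (⋃ j, polytope (Hd j)) < ⊤ :=
    (measure_iUnion_fintype_le volume _).trans_lt (ENNReal.sum_lt_top.2 fun j _ => (hP1 j).measure_lt_top)
  refine ⟨t, ht, hcovL t ht.1.le, fun x hx => mem_balls_of_tent_pos X (lt_trans ht.1 hx),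
    setOf_forall_dist_le_subset_superlevel X ht.2,
    ⟨N, Hd, hP1, hP2, hP3, hP4, fun j => ⟨lab j, hlab j, hP5 j⟩,
      fun j => ⟨(lab j).2 0, (hP5 j).trans (cellOf_subset_slab _ _)⟩, hP6, hP7, hfin, hvolU⟩,
    fun ξ hξ hξc hξK hξU => ?_, C, fun i => Finset.sum_nonneg fun j _ => hterm0 j, fun s => ?_,
    fun i ξ hξ hξc hξK hξU => ?_⟩
  · -- part V at the good level, all cells meeting `U`
    have hV := setIntegral_fieldDivergence_superlevel_le_localFacetSum H Q hQ hbd hdisj g b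
      (continuous_tent X) hf isCompact_fccWulffBody zero_mem_fccWulffBody (hcov t ht.1.le) hgen hξ hξc hξK
      hξU S hSmem
    linarith [hV, hFreal S (Finset.Subset.refl _)]
  · -- `Σ_{i ∈ s} C i ≤ Ctot`
    have hsum : ∑ i ∈ s, C i = ∑ j ∈ S.filter (fun j => (lab j).2 0 ∈ s), c j * (A j t).toReal := by
      simp only [C, Finset.sum_filter]
      rw [Finset.sum_comm]
      refine Finset.sum_congr rfl fun j _ => ?_
      rw [Finset.sum_ite_eq]
    have := hFreal (S.filter fun j => (lab j).2 0 ∈ s) (Finset.filter_subset _ S)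
    rw [← hsum] at this
    linarith
  · -- part V with the cells of slab `i`
    have hV := setIntegral_fieldDivergence_superlevel_le_localFacetSum H Q hQ hbd hdisj g b
      (continuous_tent X) hf isCompact_fccWulffBody zero_mem_fccWulffBody (hcov t ht.1.le) hgen hξ hξc hξK
      hξU (S.filter fun j => (lab j).2 0 = i) (fun j hj hne => Finset.mem_filter.2
        ⟨hSmem j hj (hne.mono (Set.inter_subset_inter_right _ Set.inter_subset_left)),
         hslab j i (hne.mono (Set.inter_subset_inter_right _ Set.inter_subset_right))⟩)
    exact hV

end Summit.Ventures.Crystal3D.TentCertificate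

end
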